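import Summits.PneNP.PneNP.Theorems.SymmetryBudgetNoHiddenOrderPerPathReplay
import Summits.PneNP.PneNP.Theorems.SymmetryBudgetNoHiddenOrderPerPathAtomsPartition

/-!
# The components-only Corneil–Goldberg CANONICAL FORM as a function (`NoHiddenOrder`, PER-PATH.md §12.2, brick B2 — definition)

Route `PneNP/SymmetryBudget`, `NoHiddenOrder` (stmt-PneNP-14781). `canon G A col : Enc` is the canonical copy of the coloured block
`(A, col)` computed by the recursion tree of PER-PATH §12.2 (B. Laubner, PhD thesis HU Berlin 2011, §3.4, with component sections only):

* `Enc := List (Lex (ℕ × List Bool))` — rows `(colour, adjacency row)` in canonical order; a linear order (lexicographic);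
* (leaf) `|A| ≤ 1`: the trivial copy; (AND) the switching graph of `(A, col)` is disconnected inside `A`: canonise the switching
  components (`swReach`, all smaller — `card_swReach_lt_of_disconnected`), SORT their copies and glue them with the uniform cross data
  (`assembleAND`: between two components a vertex of colour `k` sees a vertex of colour `k'` iff the block `(k, k')` is switched,
  `SwCompC`); (OR) switching-connected with a smallest cell of `≥ 2` vertices: the LEX-LEAST copy over the individualisations `x` of
  the first smallest cell, each computed on the finer colouring `refineIn G A (indiv col x)` (more cells —
  `card_image_lt_refineIn_indiv`) and read back in the colours of `col` (`recolour` along `colMap`); otherwise (a degenerate,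
  non-equitable input) `[]`.
* Termination by the measure `|A|·(|A|+1) − #colours` (`canonMeasure`).

Only the definition and its termination facts are here; realisation (the copy is a relabelled adjacency matrix of `(A, col)`) and
relabelling invariance are the next bricks. Definitions: `SwCompC`, `crossRow`, `assembleAND`, `recolour`, `colMap`, `canonMeasure`,
`canon`.
-/

-- `Summit.PneNP.PneNP.…` duplicates `PneNP` BY DESIGN (single-problem summit, D-0017 layout).
set_option linter.dupNamespace false

namespace Summit.PneNP.PneNP.Theorems

open Finset

namespace BranchSum

/-- Encodings of coloured blocks: rows `(colour, adjacency row)`, compared lexicographically. -/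
abbrev Enc : Type := List (Lex (ℕ × List Bool))

/-- The cross row of a vertex of colour `c` towards a block with encoding `E`: bit `sw c c'` against each row colour `c'`. -/
def crossRow (sw : ℕ → ℕ → Bool) (c : ℕ) (E : Enc) : List Bool := E.map fun r => sw c (ofLex r).1

/-- Glue the encodings of the parts of a section partition (in the given order) with uniform cross data `sw`. -/
def assembleAND (sw : ℕ → ℕ → Bool) (chs : List Enc) : Enc :=
  chs.zipIdx.flatMap fun Ej => Ej.1.map fun r =>
    toLex ((ofLex r).1, chs.zipIdx.flatMap fun Ei => if Ei.2 = Ej.2 then (ofLex r).2 else crossRow sw (ofLex r).1 Ei.1)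

/-- Rename the colours of an encoding. -/
def recolour (f : ℕ → ℕ) (E : Enc) : Enc := E.map fun r => toLex (f (ofLex r).1, (ofLex r).2)

variable {V : Type*} [DecidableEq V] (G : SimpleGraph V) [DecidableRel G.Adj]

/-- Colour-level switching predicate of the block `(A, col)`: the block between the colour classes `k`, `k'` has density `> 1/2`.
For `k = col u`, `k' = col w` this is `SwComp G A col u w`. -/
def SwCompC (A : Finset V) (col : V → ℕ) (k k' : ℕ) : Prop :=
  (A.filter fun w => col w = k).card * (A.filter fun w => col w = k').card <
    2 * (((A.filter fun w => col w = k) ×ˢ (A.filter fun w => col w = k')).filter fun p => G.Adj p.1 p.2).card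

/-- `SwCompC` is decidable. -/
instance (A : Finset V) (col : V → ℕ) (k k' : ℕ) : Decidable (SwCompC G A col k k') := by unfold SwCompC; infer_instance

omit [DecidableEq V] in
/-- `SwCompC` at the colours of two vertices is `SwComp`. -/
theorem swCompC_iff (A : Finset V) (col : V → ℕ) (u w : V) : SwCompC G A col (col u) (col w) ↔ SwComp G A col u w := Iff.rfl

/-- The colour map from a finer colouring `cs` back to `col` on `A` (the largest `col`-value on the `cs`-class; for a refinement
all values agree). -/
def colMap (A : Finset V) (cs col : V → ℕ) (k : ℕ) : ℕ := ((A.filter fun w => cs w = k).image col).sup id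

/-- The termination measure of `canon`. -/
def canonMeasure (A : Finset V) (col : V → ℕ) : ℕ := A.card * (A.card + 1) - (A.image col).card

variable {G}

/-! ### Termination facts -/

/-- In a switching-disconnected block every switching component is a proper subset. -/
theorem card_swReach_lt_of_disconnected {A : Finset V} {col : V → ℕ} (h : ∃ u ∈ A, swReach G A col u ≠ A) {K : Finset V}
    (hK : K ∈ A.image fun u => swReach G A col u) : K.card < A.card := by
  obtain ⟨w, hw, rfl⟩ := mem_image.1 hK
  refine card_lt_card ⟨swReach_subset A col w, fun hsub => ?_⟩
  have hA : swReach G A col w = A := Subset.antisymm (swReach_subset A col w) hsub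
  obtain ⟨u, hu, hne⟩ := h
  exact hne ((swReach_eq_of_mem col hw (hA.symm ▸ hu)).trans hA)

omit [DecidableEq V] in
/-- The measure of a proper sub-block is smaller. -/
theorem canonMeasure_lt_of_card_lt {A K : Finset V} (col col' : V → ℕ) (h : K.card < A.card) :
    canonMeasure K col' < canonMeasure A col := by
  unfold canonMeasure
  have h1 : (A.image col).card ≤ A.card := card_image_le
  have h2 : K.card * (K.card + 1) ≤ (A.card - 1) * A.card := Nat.mul_le_mul (by omega) (by omega)
  obtain ⟨a, ha⟩ : ∃ a, A.card = a + 1 := ⟨A.card - 1, by omega⟩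
  rw [ha] at h1 h2 ⊢
  have e1 : (a + 1 - 1) * (a + 1) + (a + 1) = (a + 1) * (a + 1) := by
    rw [Nat.add_sub_cancel]; ring
  have e2 : (a + 1) * (a + 1 + 1) = (a + 1) * (a + 1) + (a + 1) := by ring
  omega

/-- Individualising a vertex of a cell with `≥ 2` vertices and refining gives strictly more colours on `A`. -/
theorem card_image_lt_refineIn_indiv {A : Finset V} (col : V → ℕ) {x : V} (hx : x ∈ A)
    (h2 : 2 ≤ (cellOf A col x).card) : (A.image col).card < (A.image (refineIn G A (indiv col x))).card := by
  set cs := refineIn G A (indiv col x) with hcs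
  -- `col` factors through `cs` on `A`
  have href : ∀ u ∈ A, ∀ w ∈ A, cs u = cs w → col u = col w := fun u hu w hw h =>
    indiv_refines _ _ (refineIn_refines (G := G) _ hu hw h)
  obtain ⟨f, hf⟩ : ∃ f : ℕ → ℕ, ∀ u ∈ A, col u = f (cs u) := by
    refine ⟨fun k => if h : ∃ u ∈ A, cs u = k then col h.choose else 0, fun u hu => ?_⟩
    have h : ∃ w ∈ A, cs w = cs u := ⟨u, hu, rfl⟩
    show col u = (if h : ∃ w ∈ A, cs w = cs u then col h.choose else 0)
    rw [dif_pos h]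
    exact href _ hu _ h.choose_spec.1 h.choose_spec.2.symm
  have himage : A.image col = (A.image cs).image f := by
    ext k
    simp only [mem_image]
    constructor
    · rintro ⟨u, hu, rfl⟩; exact ⟨cs u, ⟨u, hu, rfl⟩, (hf u hu).symm⟩
    · rintro ⟨_, ⟨u, hu, rfl⟩, rfl⟩; exact ⟨u, hu, hf u hu⟩
  rw [himage]
  refine lt_of_le_of_ne card_image_le fun heq => ?_
  -- `f` injective on the `cs`-colours would identify `x` with another vertex of its `col`-cell
  have hinj := card_image_iff.1 heq
  obtain ⟨y, hy, hyx⟩ : ∃ y ∈ cellOf A col x, y ≠ x := by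
    by_contra hno
    push Not at hno
    have : cellOf A col x ⊆ {x} := fun y hy => mem_singleton.2 (hno y hy)
    have := card_le_card this
    rw [card_singleton] at this
    omega
  rw [mem_cellOf_iff] at hy
  have hcsxy : cs y = cs x := by
    apply hinj (mem_coe.2 (mem_image_of_mem cs hy.1)) (mem_coe.2 (mem_image_of_mem cs hx))
    rw [← hf y hy.1, ← hf x hx]; exact hy.2
  have hmem : y ∈ cellOf A cs x := mem_cellOf_iff.2 ⟨hy.1, hcsxy⟩
  have hsingle : cellOf A cs x = {x} := by rw [hcs]; exact cellOf_refineIn_indiv col hx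
  rw [hsingle, mem_singleton] at hmem
  exact hyx hmem

/-- The measure after an OR-step is smaller. -/
theorem canonMeasure_lt_refineIn_indiv {A : Finset V} (col : V → ℕ) {x : V} (hx : x ∈ A) (h2 : 2 ≤ (cellOf A col x).card) :
    canonMeasure A (refineIn G A (indiv col x)) < canonMeasure A col := by
  unfold canonMeasure
  have h1 := card_image_lt_refineIn_indiv (G := G) col hx h2
  have h3 : (A.image (refineIn G A (indiv col x))).card ≤ A.card := card_image_le
  have h4 : A.card ≤ A.card * (A.card + 1) := Nat.le_mul_of_pos_right _ (Nat.succ_pos _)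
  omega

variable (G)

/-- **The canonical copy of a coloured block** (components-only Corneil–Goldberg recursion; PER-PATH §12.2). -/
noncomputable def canon (A : Finset V) (col : V → ℕ) : Enc :=
  if A.card ≤ 1 then A.toList.map fun u => toLex (col u, [false])
  else if hAND : ∃ u ∈ A, swReach G A col u ≠ A then
    assembleAND (fun k k' => decide (SwCompC G A col k k'))
      ((((A.image fun u => swReach G A col u).attach.toList.map fun K => canon K.1 col)).insertionSort (· ≤ ·))
  else if hOR : 2 ≤ (smallestCell A col).card then
    ((smallestCell A col).attach.image fun x =>
        recolour (colMap A (refineIn G A (indiv col x.1)) col) (canon A (refineIn G A (indiv col x.1)))).min'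
      (by
        have hne : (smallestCell A col).Nonempty := card_pos.1 (by omega)
        obtain ⟨x, hx⟩ := hne
        exact ⟨_, mem_image_of_mem _ (mem_attach _ ⟨x, hx⟩)⟩)
  else []
termination_by canonMeasure A col
decreasing_by
  all_goals
    first
    | exact canonMeasure_lt_of_card_lt col col (card_swReach_lt_of_disconnected hAND K.2)
    | exact canonMeasure_lt_refineIn_indiv (G := G) col (smallestCell_subset A col x.2)
        (by rw [← smallestCell_eq_cellOf col x.2]; exact hOR)
    | exact canonMeasure_lt_refineIn_indiv (G := G) col (smallestCell_subset A col hx)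
        (by rw [← smallestCell_eq_cellOf col hx]; exact hOR)

end BranchSum

end Summit.PneNP.PneNP.Theorems
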